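import Literature.NumberTheory.GaloisCohomology.Howard2004.FiniteSingularTameAdmissible
import Literature.NumberTheory.GaloisCohomology.Howard2004.DVRKolyvaginBound
import Literature.NumberTheory.GaloisCohomology.Howard2004.PiAdicRefinement
import HarnessLib

/-!
# Howard 2004, Prop. 1.1.7 / Def. 1.1.8: the inputs of the slot-unit comparison — `H¹_ur` is carried ONTO `H¹_ur`
# by the reductions and transitions, and `T^{(k)}/I_m` carries a unimodular pair (theorems only)

Topic `NumberTheory/GaloisCohomology/Howard2004` (sequel to `FiniteSingularEvaluation` (Prop. 1.1.7: `H¹_ur(K_v, N) ≅ N`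
by evaluation at a Frobenius, `evalClass_bijective_unramified`), `FiniteSingularTame` (`evalClass_localH1Map`),
`FiniteSingularTameAdmissible` (`trivial_toLocal_of_mem_level_of_h0`) and `FiniteSingularSlotUnits[Transfer]Proofs`,
whose «Not here» this file supplies).  THEOREMS ONLY: no definition, no named fact, no instance, no notation, no `sorry`.

WHY (INPUTS row G87 = `Howard2004.thm161_dvrKolyvaginBound` = Howard Thm. 1.6.1; stub `stub_h161` of the μ-crux
stmt-BirchSwinnertonDyer-22642; cell `pub/bsd-print-x9`, seat `bsd-line-x10b-p1-w7` g8, brick (TAME-WLOG) «thm161 for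
tame-pinned settings ⇒ thm161 as typed», bsd-line-x10b-p1 LEAD g12 (O3)).  The comparison of two admissible
finite–singular slots (`LevelData.exists_unit_fs_eq_sqSMul_of_natural`: `fs₂ = u · fs` at one pair `(m, λ)`) and
its transfers in `n` and `k` (`fs_eq_sqSMul_transfer`, `DVRSetting.fs_eq_sqSMul_transfer_red`) take as hypotheses
(1) a unimodular pair on `T/I_mT` over `R/I_m` and `T/I_mT` being `I_m`-torsion, (2) the surjectivity ON THE FINITE
(= unramified) CLASSES of `H¹(K_λ, g)` for the transition `g : T/I_mT ↠ T/I_nT` and of the reduction `rqLocH1`.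
This file proves them on a `DVRSetting` with H.0–H.5:

* §1 (generic, any finite modules with trivial local action) **`exists_mem_unramified_localH1Map_eq`** /
  `exists_mem_unramified_cohomologyMap_toLocal_eq` — a SURJECTIVE locally equivariant `g : N ↠ N'` is onto on
  `H¹_ur(K_v, ·)` (evaluation at an arithmetic Frobenius is a bijection `H¹_ur ≅ N` natural in `g`);
* §2 `DVRSetting.rq_surjective`, **`exists_mem_unramified_rqLocH1_eq`** (the `hsurj` of `fs_eq_sqSMul_transfer_red`),
  `transition_surjective`, **`exists_mem_unramified_transition_eq`** (the `hsurj` of `fs_eq_sqSMul_transfer` along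
  `T^{(k)}/I_m ↠ T^{(k)}/I_n`, `m ⊆ n`) — trivial local actions at `λ ∈ m ⊆ n ∈ 𝓝(𝓛)` by H.0;
* §3 `isTorsionBySet_levelQuotient` (`I_m` kills `T^{(k)}/I_m`), **`exists_unimodular_levelQuotient`** (`x₀`,
  `φ : T^{(k)}/I_m →ₗ[R_k] R_k/I_m`, `φ x₀ = 1`, from H.0 — the hypotheses `hI`, `x₀`, `φ`, `hφ` of
  `exists_unit_fs_eq_sqSMul_of_natural`).

HONEST FRAMING: functoriality bookkeeping; `thm161_dvrKolyvaginBound` is NOT proved; no summit statement is proved; the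
Birch–Swinnerton-Dyer conjecture is not proved by any of this.
References: [Howard2004HeegnerKolyvagin] B. Howard, Compositio Math. 140 (2004), Prop. 1.1.7, Def. 1.1.8, Def. 1.1.3,
Def. 1.2.1–1.2.3, H.0, §1.6 (arXiv:1202.6340 p. 5 L93–99 and L115–138, p. 6 L63–75, p. 7 L1–12 and L57, p. 11 L45–50);
[SerreLocalFields1979] XIII §1.
-/

set_option autoImplicit false

noncomputable section

open Function NumberField IsDedekindDomain Field
open scoped NumberField ContRepresentation Classical TensorProduct

namespace Literature.NumberTheory.GaloisCohomology.Howard2004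

open Literature.NumberTheory.GaloisRepresentations
open Literature.NumberTheory.GaloisRepresentations.DiscreteGaloisModule
open Literature.NumberTheory.GaloisRepresentations.IsNonarchimedeanLocalField

/-! ## §1 Generic: a surjective locally equivariant map of modules with trivial local action is onto on `H¹_ur` -/

section Generic

variable {K : Type} [Field K] [NumberField K]
  {N : Type} [AddCommGroup N] [TopologicalSpace N] [DiscreteTopology N]
  {N' : Type} [AddCommGroup N'] [TopologicalSpace N'] [DiscreteTopology N']

/-- **`H¹_ur(K_v, g)` is onto for a SURJECTIVE `g : N → N'` between finite modules with trivial local action**: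
through the evaluation isomorphisms `H¹_ur(K_v, ·) ≅ ·` at an arithmetic Frobenius (Prop. 1.1.7, functorial in the
module) this is the surjectivity of `g`.
[cite: Howard2004HeegnerKolyvagin, Prop. 1.1.7 (arXiv:1202.6340 Prop. 2.1.7, p. 5 L129–138)] -/
theorem exists_mem_unramified_localH1Map_eq [Finite N] [Finite N'] (ρ : DiscreteGaloisModule K N)
    (ρ' : DiscreteGaloisModule K N') (v : HeightOneSpectrum (𝓞 K)) (g : N →+ N')
    (hg : ∀ (σ : absoluteGaloisGroup (v.adicCompletion K)) (x : N),
      g (GaloisRep.toLocal v ρ σ x) = GaloisRep.toLocal v ρ' σ (g x))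
    (hsurj : Surjective g)
    (htriv : ∀ (σ : absoluteGaloisGroup (v.adicCompletion K)) (x : N), GaloisRep.toLocal v ρ σ x = x)
    (htriv' : ∀ (σ : absoluteGaloisGroup (v.adicCompletion K)) (x : N'), GaloisRep.toLocal v ρ' σ x = x) :
    ∀ c' ∈ unramifiedSubgroup (GaloisRep.toLocal v ρ') 1,
      ∃ c ∈ unramifiedSubgroup (GaloisRep.toLocal v ρ) 1, localH1Map ρ ρ' v g hg c = c' := by
  intro c' hc'
  obtain ⟨φ, hφ⟩ := exists_isAbsArithFrob_holds (F := v.adicCompletion K)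
  have hφ1 : IsFrobPow φ 1 := IsAbsArithFrob.isFrobPow_holds hφ
  obtain ⟨t, ht⟩ := hsurj (evalClass (GaloisRep.toLocal v ρ') htriv' φ c')
  obtain ⟨c, hc, hct⟩ := exists_mem_unramified_evalClass_eq (GaloisRep.toLocal v ρ) htriv hφ1 t
  refine ⟨c, hc, ?_⟩
  have hmem : localH1Map ρ ρ' v g hg c ∈ unramifiedSubgroup (GaloisRep.toLocal v ρ') 1 :=
    localH1Map_mem_unramifiedSubgroup ρ ρ' v g hg hc
  have key := (evalClass_bijective_unramified (GaloisRep.toLocal v ρ') htriv' hφ1).1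
    (a₁ := ⟨_, hmem⟩) (a₂ := ⟨c', hc'⟩) (by
      change evalClass (GaloisRep.toLocal v ρ') htriv' φ (localH1Map ρ ρ' v g hg c) =
        evalClass (GaloisRep.toLocal v ρ') htriv' φ c'
      rw [evalClass_localH1Map ρ ρ' v g hg htriv htriv', hct, ht])
  exact congrArg Subtype.val key

/-- The same for `ContinuousRep.cohomologyMap` of the local modules (the currency of `rqLocH1`).
[cite: Howard2004HeegnerKolyvagin, Prop. 1.1.7 (arXiv p. 5 L129–138)] -/
theorem exists_mem_unramified_cohomologyMap_toLocal_eq [Finite N] [Finite N'] (ρ : DiscreteGaloisModule K N)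
    (ρ' : DiscreteGaloisModule K N') (v : HeightOneSpectrum (𝓞 K)) (g : N →+ N')
    (hg : ∀ (σ : absoluteGaloisGroup (v.adicCompletion K)) (x : N),
      g (GaloisRep.toLocal v ρ σ x) = GaloisRep.toLocal v ρ' σ (g x))
    (hsurj : Surjective g)
    (htriv : ∀ (σ : absoluteGaloisGroup (v.adicCompletion K)) (x : N), GaloisRep.toLocal v ρ σ x = x)
    (htriv' : ∀ (σ : absoluteGaloisGroup (v.adicCompletion K)) (x : N'), GaloisRep.toLocal v ρ' σ x = x) :
    ∀ c' ∈ unramifiedSubgroup (GaloisRep.toLocal v ρ') 1,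
      ∃ c ∈ unramifiedSubgroup (GaloisRep.toLocal v ρ) 1,
        ContinuousRep.cohomologyMap (GaloisRep.toLocal v ρ) (GaloisRep.toLocal v ρ') g
          continuous_of_discreteTopology hg 1 c = c' :=
  exists_mem_unramified_localH1Map_eq ρ ρ' v g hg hsurj htriv htriv'

end Generic

/-! ## §2 On a `DVRSetting`: the level reductions and the `Quot`-transitions are onto on the finite classes -/

namespace DVRSetting

variable {p : ℕ} [Fact p.Prime] {K : Type} [Field K] [NumberField K]
  {R : Type} [CommRing R] [IsDomain R] [IsDiscreteValuationRing R] [Algebra ℤ_[p] R]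
  {N : ℕ → Type} [∀ k, AddCommGroup (N k)] [∀ k, TopologicalSpace (N k)]
  [∀ k, DiscreteTopology (N k)] [∀ k, Module R (N k)]
  {Rk : ℕ → Type} [∀ k, CommRing (Rk k)] [∀ k, IsLocalRing (Rk k)] [∀ k, TopologicalSpace (Rk k)]
  [∀ k, DiscreteTopology (Rk k)] [∀ k, Algebra ℤ_[p] (Rk k)] [∀ k, Algebra R (Rk k)]
  [∀ k, Module (Rk k) (N k)] [∀ k, IsScalarTower R (Rk k) (N k)]
  {Nbar : Type} [AddCommGroup Nbar] [TopologicalSpace Nbar] [DiscreteTopology Nbar]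
  [∀ k, Module (Rk k) Nbar]
  {Nq : ℕ → Finset (HeightOneSpectrum (𝓞 K)) → Type} [∀ k n, AddCommGroup (Nq k n)]
  [∀ k n, TopologicalSpace (Nq k n)] [∀ k n, DiscreteTopology (Nq k n)]
  [∀ k n, Module (Rk k) (Nq k n)] [∀ k n, Module R (Nq k n)]
  [∀ k n, IsScalarTower R (Rk k) (Nq k n)]

/-- The reductions `T^{(k+1)}/I_n → T^{(k)}/I_n` are onto (`rq ∘ π = π ∘ red` with `π`, `red` onto).
[cite: Howard2004HeegnerKolyvagin, §1.6 (arXiv p. 11, L45–50)] -/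
theorem rq_surjective (S : DVRSetting p K R N Rk Nbar Nq) (k : ℕ) (n : Finset (HeightOneSpectrum (𝓞 K))) :
    Surjective (S.rq k n) := by
  intro y
  obtain ⟨x, rfl⟩ := ((S.LD k).isQuotientBy n).surjective y
  obtain ⟨x', rfl⟩ := S.T.red_surjective k x
  exact ⟨(S.LD (k + 1)).π n x', S.rq_comp k n x'⟩

/-- **`rqLocH1 k n λ` is onto on the finite classes** at `λ ∈ n ∈ 𝓝(𝓛)` (trivial local action on both levels by
H.0). [cite: Howard2004HeegnerKolyvagin, Prop. 1.1.7 and §1.6 (arXiv p. 5 L129–138, p. 11 L45–50)] -/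
theorem exists_mem_unramified_rqLocH1_eq [∀ k n, Finite (Nq k n)] (S : DVRSetting p K R N Rk Nbar Nq)
    (hy : S.SatisfiesH) (k : ℕ) {n : Finset (HeightOneSpectrum (𝓞 K))} {v : HeightOneSpectrum (𝓞 K)}
    (hn : n ∈ (S.t k).levelSet) (hn' : n ∈ (S.t (k + 1)).levelSet) (hv : v ∈ n) :
    ∀ c' ∈ unramifiedSubgroup (GaloisRep.toLocal v ((S.LD k).ρq n)) 1,
      ∃ c ∈ unramifiedSubgroup (GaloisRep.toLocal v ((S.LD (k + 1)).ρq n)) 1, S.rqLocH1 k n v c = c' :=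
  exists_mem_unramified_cohomologyMap_toLocal_eq ((S.LD (k + 1)).ρq n) ((S.LD k).ρq n) v
    (S.rq k n).toAddMonoidHom (fun _ y => S.rq_equivariant k n _ y) (S.rq_surjective k n)
    (trivial_toLocal_of_mem_level_of_h0 (hy.h0 (k + 1)) (S.LD (k + 1)) hn' hv)
    (trivial_toLocal_of_mem_level_of_h0 (hy.h0 k) (S.LD k) hn hv)

/-- The `Quot`-transition `T^{(k)}/I_m → T^{(k)}/I_n` (`m ⊆ n`) between the presentations of one level is onto.
[cite: Howard2004HeegnerKolyvagin, Def. 1.1.3 and Def. 1.2.1 (arXiv p. 5 L93–99, p. 6 L73–75)] -/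
theorem transition_surjective (S : DVRSetting p K R N Rk Nbar Nq) (k : ℕ)
    {m n : Finset (HeightOneSpectrum (𝓞 K))} (hmn : m ⊆ n) :
    Surjective (((S.LD k).isQuotientBy m).transition ((S.LD k).isQuotientBy n)
      (levelIdeal_mono (S.T.ρ k) hmn)) := by
  intro y
  obtain ⟨x, rfl⟩ := ((S.LD k).isQuotientBy n).surjective y
  exact ⟨(S.LD k).π m x, IsQuotientBy.transition_apply _ _ _ x⟩

/-- **`H¹(K_λ, T^{(k)}/I_m → T^{(k)}/I_n)` is onto on the finite classes** for `λ ∈ m ⊆ n ∈ 𝓝(𝓛)`.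
[cite: Howard2004HeegnerKolyvagin, Prop. 1.1.7 and Def. 1.1.3 (arXiv p. 5 L93–99 and L129–138)] -/
theorem exists_mem_unramified_transition_eq [∀ k n, Finite (Nq k n)] (S : DVRSetting p K R N Rk Nbar Nq)
    (hy : S.SatisfiesH) (k : ℕ) {m n : Finset (HeightOneSpectrum (𝓞 K))} {v : HeightOneSpectrum (𝓞 K)}
    (hmn : m ⊆ n) (hm : m ∈ (S.t k).levelSet) (hn : n ∈ (S.t k).levelSet) (hv : v ∈ m) :
    ∀ c' ∈ unramifiedSubgroup (GaloisRep.toLocal v ((S.LD k).ρq n)) 1,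
      ∃ c ∈ unramifiedSubgroup (GaloisRep.toLocal v ((S.LD k).ρq m)) 1,
        localH1Map ((S.LD k).ρq m) ((S.LD k).ρq n) v
          (((S.LD k).isQuotientBy m).transition ((S.LD k).isQuotientBy n)
            (levelIdeal_mono (S.T.ρ k) hmn)).toAddMonoidHom
          (fun _ x => ((S.LD k).isQuotientBy m).transition_equivariant ((S.LD k).isQuotientBy n)
            (levelIdeal_mono (S.T.ρ k) hmn) _ x) c = c' :=
  exists_mem_unramified_localH1Map_eq ((S.LD k).ρq m) ((S.LD k).ρq n) v _
    (fun _ x => ((S.LD k).isQuotientBy m).transition_equivariant ((S.LD k).isQuotientBy n)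
      (levelIdeal_mono (S.T.ρ k) hmn) _ x) (S.transition_surjective k hmn)
    (trivial_toLocal_of_mem_level_of_h0 (hy.h0 k) (S.LD k) hm hv)
    (trivial_toLocal_of_mem_level_of_h0 (hy.h0 k) (S.LD k) hn (hmn hv))


/-! ## §3 `T^{(k)}/I_m` is `I_m`-torsion and carries a unimodular pair over `R_k/I_m` (H.0) -/

/-- `T^{(k)}/I_m T^{(k)}` (the presentation `Nq k m`) is killed by `I_m` (`ker π = I_m·T^{(k)}`, `π` onto).
[cite: Howard2004HeegnerKolyvagin, Def. 1.1.3 and Def. 1.2.3 (arXiv p. 5 L93–99, p. 7 L1–6)] -/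
theorem isTorsionBySet_levelQuotient (S : DVRSetting p K R N Rk Nbar Nq) (k : ℕ)
    (m : Finset (HeightOneSpectrum (𝓞 K))) :
    Module.IsTorsionBySet (Rk k) (Nq k m) (levelIdeal (R := Rk k) (S.T.ρ k) m : Set (Rk k)) := by
  rintro y ⟨a, ha⟩
  obtain ⟨x, rfl⟩ := ((S.LD k).isQuotientBy m).surjective y
  change a • (S.LD k).π m x = 0
  rw [← LinearMap.map_smul, ← LinearMap.mem_ker, ((S.LD k).isQuotientBy m).ker_eq]
  exact Submodule.smul_mem_smul ha Submodule.mem_top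

/-- **A unimodular pair on `T^{(k)}/I_m` over `R_k/I_m`** from H.0 (`T^{(k)}` free of rank two over `R_k`): the image
`x₀` of a basis vector and the corresponding coordinate read modulo `I_m`, descended to the quotient (`φ x₀ = 1`).
[cite: Howard2004HeegnerKolyvagin, H.0 and Def. 1.1.3 (arXiv p. 7 L57, p. 5 L93–99)] -/
theorem exists_unimodular_levelQuotient (S : DVRSetting p K R N Rk Nbar Nq) (hy : S.SatisfiesH) (k : ℕ)
    (m : Finset (HeightOneSpectrum (𝓞 K))) :
    ∃ (x₀ : Nq k m) (φ : Nq k m →ₗ[Rk k] Rk k ⧸ levelIdeal (R := Rk k) (S.T.ρ k) m), φ x₀ = 1 := by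
  obtain ⟨hfree, hrank⟩ := hy.h0 k
  haveI : Nontrivial (N k) := Module.nontrivial_of_finrank_eq_succ (R := Rk k) hrank
  let b := Module.Free.chooseBasis (Rk k) (N k)
  obtain ⟨i₀⟩ := b.index_nonempty
  let ψ : N k →ₗ[Rk k] Rk k ⧸ levelIdeal (R := Rk k) (S.T.ρ k) m :=
    (Ideal.Quotient.mkₐ (Rk k) (levelIdeal (R := Rk k) (S.T.ρ k) m)).toLinearMap.comp (b.coord i₀)
  have hker : LinearMap.ker ((S.LD k).π m) ≤ LinearMap.ker ψ := by
    rw [((S.LD k).isQuotientBy m).ker_eq]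
    refine Submodule.smul_le.mpr fun a ha x _ => ?_
    rw [LinearMap.mem_ker, LinearMap.map_smul]
    change Ideal.Quotient.mk _ (a • b.coord i₀ x) = 0
    rw [smul_eq_mul, Ideal.Quotient.eq_zero_iff_mem]
    exact Ideal.mul_mem_right _ _ ha
  refine ⟨(S.LD k).π m (b i₀), descend ((S.LD k).π m) ((S.LD k).isQuotientBy m).surjective ψ hker, ?_⟩
  rw [descend_apply]
  change Ideal.Quotient.mk _ (b.coord i₀ (b i₀)) = 1
  rw [Module.Basis.coord_apply, b.repr_self, Finsupp.single_eq_same, map_one]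

end DVRSetting

end Literature.NumberTheory.GaloisCohomology.Howard2004

end
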